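import Summits.ABC.IUTFork.Joshi.ThetaLociPadicLogGeneral
import Summits.ABC.IUTFork.Joshi.LogVolumesHullsLocalField
import HarnessLib

/-!
# (9.9.2)–(9.9.3) / `NormLogBK` SUPPLIED for the MODULE `|−|_E = ‖−‖^d` — the Vol-compatible absolute value of §9.10.2

Proof-only rider (abc-iut cell, branch E, rung LADDER-ABC:A2.E; seat abc-iut-E-t56, [J-III] lane-B typer-side reader; INFO I2
of my read of p434712, STATUS 2026-08-26T09:30Z) on abc-iut-E-t22's `Joshi/ThetaLociPadicLogGeneral.lean` (p434712: Lemma 9.8.2.7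
for every `p`-adic field, K. Joshi arXiv:2401.13508v4 p.117 l.159–161, and the T-55-pattern supply `ScalingDatum.normLogBK_of_logReading`
of abc-iut-E-t23's input `LogVol.ScalingDatum.NormLogBK` (p429684) under the reading `habs : (D i).abs = ‖·‖`).

WHY. For the intended §9.10.2 volume datum of a local field `L′_{w,j}` — Haar measure normalised by `Vol(𝒪) = 1` and Lemma
9.10.2.2 (2) «`Vol(λ𝒪) = |λ|`» (p.123 l.24–38) — the absolute value is FORCED to be the MODULE `‖−‖^d`, `d = [L′_w : ℚ_p]`
(abc-iut-E-t23 p432005 `localFieldVolumeDatum`: `[𝒪 : p𝒪] = p^d`), which is the ℚ_p-algebra norm `‖−‖` only when `d = 1`. Lemma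
9.8.2.7 supports the module verbatim (raise `‖τ‖ = ‖q‖` to the `d`-th power), so the supply extends to EVERY `L′_w` with its
Vol-compatible absolute value: `habs` is widened to «`(D i).abs = ‖−‖^{d_i}` for some `d_i`» (`normLogBK_of_logReading_mod`), and
E-t23's chain follows as in p434712 (`valuationScaling_of_logReading_mod`, `fundamentalEstimateSup_of_logReading_mod`,
`cor91111_of_logReading_mod`). Classical mathematics; 0 definitions; E-t22's and E-t23's decls BY NAME; nothing of Joshi's
construction and no clause of [IUTchIII] Cor. 3.12 is asserted; no side taken on any author; typed ≠ proved.
-/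

noncomputable section

namespace Summit.ABC.IUTFork.Joshi.LogVol.ScalingDatum

open Literature.IUT.LogVolume Summit.ABC.IUTFork.Joshi.ATS3 Literature.AnabelianGeometry.AbsoluteAnabelian
  Literature.NumberTheory.GaloisRepresentations.Ultrametric

variable {p : ℕ} [hp : Fact p.Prime]
variable {lstar : ℕ} {E : Fin lstar → Type} [instN : ∀ i, NontriviallyNormedField (E i)]
  [instE : ∀ i, NormedAlgebra ℚ_[p] (E i)] [instU : ∀ i, IsUltrametricDist (E i)] [instC : ∀ i, CompleteSpace (E i)]
  [∀ i, MeasurableSpace (E i)] {X : Type} [MeasurableSpace X] (Dw : ScalingDatum lstar E X)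

include instE instU instC in
/-- **E-t23's `NormLogBK` ((9.9.2)–(9.9.3)) SUPPLIED for MODULE-type absolute values**: at every scaling datum (p429684) whose
factor absolute values are POWERS of the norm, `|x|_{L′_{w,j}} = ‖x‖^{d_j}` (the Vol-compatible module of §9.10.2 has
`d_j = [L′_{w,j} : ℚ_p]`, p432005; `d_j = 1` is p434712's case), and whose exhibited element is READ as (9.7.2.2) prescribes,
`τ_j = p*⁻¹·log_{L′_{w,j}}(1 + p*·q^{1/2ℓ}_{w;j})` with `q^{1/2ℓ}_{w;j} ∈ 𝒪`: then `|τ_j| = |q^{1/2ℓ}_{w;j}|` for every `j` — Lemma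
9.8.2.7 (p434712 `norm_pStar_inv_mul_unitLog_one_add_mul`) raised to the `d_j`-th power. [claim: Joshi2024ATS3, status: disputed] -/
theorem normLogBK_of_logReading_mod (d : Fin lstar → ℕ) (habs : ∀ i (x : E i), (Dw.D i).abs x = ‖x‖ ^ d i)
    (hτ : ∀ i, Dw.τ i = (((pStar p : ℕ) : E i))⁻¹ * unitLog (1 + ((pStar p : ℕ) : E i) * Dw.qrt i))
    (hq : ∀ i, ‖Dw.qrt i‖ ≤ 1) : Dw.NormLogBK := by
  intro i
  rw [habs, habs, hτ i, norm_pStar_inv_mul_unitLog_one_add_mul p (E i) (hq i)]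

include instE instU instC in
/-- The same with the integrality `‖q^{1/2ℓ}_{w;j}‖ ≤ 1` DERIVED from (9.9.4) `RootScaling e`, any exponent law `e ≥ 0`, when every
`d_j ≠ 0` (`‖q‖^{d} = qroot^{e} ≤ 1` ⇒ `‖q‖ ≤ 1`). [claim: Joshi2024ATS3, status: disputed] -/
theorem normLogBK_of_logReading_mod_of_rootScaling (d : Fin lstar → ℕ) (hd : ∀ i, d i ≠ 0)
    (habs : ∀ i (x : E i), (Dw.D i).abs x = ‖x‖ ^ d i)
    (hτ : ∀ i, Dw.τ i = (((pStar p : ℕ) : E i))⁻¹ * unitLog (1 + ((pStar p : ℕ) : E i) * Dw.qrt i))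
    {e : Fin lstar → ℝ} (he : ∀ i, 0 ≤ e i) (hsc : Dw.RootScaling e) : Dw.NormLogBK := by
  refine Dw.normLogBK_of_logReading_mod d habs hτ fun i => ?_
  have h1 : ‖Dw.qrt i‖ ^ d i ≤ 1 := by
    rw [← habs, hsc i]
    exact Real.rpow_le_one Dw.qroot_pos.le Dw.qroot_lt_one.le (he i)
  exact (pow_le_one_iff_of_nonneg (norm_nonneg _) (hd i)).1 h1

include instE instU instC in
/-- Hence E-t4's `ValuationScaling` for the projection under the MODULE reading needs only (9.9.4) with print's exponent law
(E-t23's `valuationScaling_of`, input `NormLogBK` discharged). [claim: Joshi2024ATS3, status: disputed] -/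
theorem valuationScaling_of_logReading_mod (d : Fin lstar → ℕ) (hd : ∀ i, d i ≠ 0)
    (habs : ∀ i (x : E i), (Dw.D i).abs x = ‖x‖ ^ d i)
    (hτ : ∀ i, Dw.τ i = (((pStar p : ℕ) : E i))⁻¹ * unitLog (1 + ((pStar p : ℕ) : E i) * Dw.qrt i))
    (hsc : Dw.RootScaling (ATS3.LocusDatum.scalingExponent lstar)) : Dw.toLocusDatum.ValuationScaling :=
  Dw.valuationScaling_of
    (Dw.normLogBK_of_logReading_mod_of_rootScaling d hd habs hτ (ATS3.LocusDatum.scalingExponent_nonneg) hsc) hsc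

include instE instU instC in
/-- … Thm. 9.9.1 at `w` for the projection under the MODULE reading (E-t23's `fundamentalEstimateSup_of_inputs`).
[claim: Joshi2024ATS3, status: disputed] -/
theorem fundamentalEstimateSup_of_logReading_mod (d : Fin lstar → ℕ) (hd : ∀ i, d i ≠ 0)
    (habs : ∀ i (x : E i), (Dw.D i).abs x = ‖x‖ ^ d i)
    (hτ : ∀ i, Dw.τ i = (((pStar p : ℕ) : E i))⁻¹ * unitLog (1 + ((pStar p : ℕ) : E i) * Dw.qrt i))
    (hsc : Dw.RootScaling (ATS3.LocusDatum.scalingExponent lstar)) (hcr : Dw.CrossNorm) :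
    Dw.toLocusDatum.FundamentalEstimateSup :=
  Dw.fundamentalEstimateSup_of_inputs
    (Dw.normLogBK_of_logReading_mod_of_rootScaling d hd habs hτ (ATS3.LocusDatum.scalingExponent_nonneg) hsc) hsc hcr

include instE instU instC in
/-- … Cor. 9.11.1.1 at `w` for the projection under the MODULE reading (E-t23's `cor91111_of_inputs`).
[claim: Joshi2024ATS3, status: disputed] -/
theorem cor91111_of_logReading_mod (d : Fin lstar → ℕ) (hd : ∀ i, d i ≠ 0)
    (habs : ∀ i (x : E i), (Dw.D i).abs x = ‖x‖ ^ d i)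
    (hτ : ∀ i, Dw.τ i = (((pStar p : ℕ) : E i))⁻¹ * unitLog (1 + ((pStar p : ℕ) : E i) * Dw.qrt i))
    (hsc : Dw.RootScaling (ATS3.LocusDatum.scalingExponent lstar)) (hsg : Dw.toLocusDatum.LogVolNonpos) :
    Dw.toLocusDatum.Cor91111 :=
  Dw.cor91111_of_inputs
    (Dw.normLogBK_of_logReading_mod_of_rootScaling d hd habs hτ (ATS3.LocusDatum.scalingExponent_nonneg) hsc) hsc hsg

include instE instU instC in
/-- **At E-t23's Vol-compatible local-field datum** (p432005 `localFieldVolumeDatum K hϖ hd hmod`, whose `abs` IS the module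
`modAbs K d`): the MODULE reading `habs` holds by `rfl` (`modAbs_apply`), so `NormLogBK` is supplied there for every `L′_w`,
ramified or not, under the (9.7.2.2) reading of `τ_j` alone. [claim: Joshi2024ATS3, status: disputed] -/
theorem normLogBK_of_logReading_localField [∀ i, ProperSpace (E i)] [∀ i, BorelSpace (E i)]
    (ϖ : ∀ i, (E i)ˣ) (hϖ : ∀ i, IsUniformizer (ϖ i))
    (d : Fin lstar → ℕ) (hd : ∀ i, d i ≠ 0)
    (hmod : ∀ i, ‖(ϖ i : E i)‖ ^ d i = ((residueCard (E i) : ℝ))⁻¹)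
    (hD : ∀ i, Dw.D i = localFieldVolumeDatum (E i) (hϖ i) (hd i) (hmod i))
    (hτ : ∀ i, Dw.τ i = (((pStar p : ℕ) : E i))⁻¹ * unitLog (1 + ((pStar p : ℕ) : E i) * Dw.qrt i))
    (hq : ∀ i, ‖Dw.qrt i‖ ≤ 1) : Dw.NormLogBK :=
  Dw.normLogBK_of_logReading_mod d (fun i x => by rw [hD i]; rfl) hτ hq

end Summit.ABC.IUTFork.Joshi.LogVol.ScalingDatum

end
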